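import Mathlib
import Summits.ResolutionOfSingularities.ResolutionOfSingularities.Theorems.FrobeniusClosingSteerHironakaLUBranchOfCPPrelims
import Summits.ResolutionOfSingularities.ResolutionOfSingularities.Theorems.FrobeniusClosingSteerNoEternalChainThree
import Literature.AlgebraicGeometry.Resolution.ArithmeticalThreefoldsLocalPermissibleProofs
import Literature.AlgebraicGeometry.Resolution.CossartPiltantHironakaLocalUniformizationBranch
import HarnessLib

/-!
# Crux `Steer` (stmt-ResolutionOfSingularities-16345), chain W4.1: the K(3) debt migrates to the printed shape of
# Cossart–Piltant's local theorem — `CossartPiltant2019LocalPermissibleSing → CossartPiltant2019HironakaLUIsolatedBranch`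

OURS (campaign `res-hironaka`, rung L ★L-G4, slot W4.1, seat `res-type-026`; res-L0-w41-plan-1 RULING 2
2026-08-27T07:20:27Z «GO as VERBATIM REFINEMENT (reviewer insurance for p508501)»; NOT a statement of the
manuscript under review; AI review is weaker than expert review).  K(3) (`NoEternalIsolatedRadicandChain p 3`) is
CLOSED modulo `CossartPiltant2019HironakaLUIsolatedBranch` (res-L0-w41-lead-1, p508501; consumer p509311), a
BRANCH-LOCAL special case of Cossart–Piltant 2019 Thm. 1.5 [v1 Thm. 1.4] (i) whose reduction to print is an argument
in its docstring.  This file PROVES that special case from `CossartPiltant2019LocalPermissibleSing` (p510806): the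
local theorem IN ITS PRINTED SHAPE (a finite tower of local Hironaka-permissible blowing ups along `μ` ending regular,
centre clause read flatness-free), so the chain's debt sits on a verbatim-shaped statement of the source; and,
through Bennett (`localPermissibleSing_of_localPermissible`, p511703), from `CossartPiltant2019LocalPermissible`.
Prelims: `…HironakaLUBranchOfCPPrelims.lean`.

Proof.  Suppose every germ `T i = (S i)[X]/(X^p − f i)` is singular.  (1) Realise the germs in one field
`K′ = Frac(S 0)[θ]/(θ^p − f 0)` as res-L1-type-o8's chain `R i := realR i` (quadratic-transform law re-run without
the cleaning binder: locality from `f i − (θ i)^p = (u i)^p f (i+1) ∈ 𝔪_i`); every `R i ≅ T i` is singular with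
ISOLATED singularity.  (2) Chevalley: a valuation ring `O′` of `K′` dominates every `R i`, so `R (i+1)` is THE
quadratic transform of `R i` along `O′` (`IsQuadraticTransform.along`, `IsQuadraticTransformAlong.unique`).
(3) Frame of the fact: `R := im(S 0)`, `h = X^p − f 0`, `x = θ`, (MIN) from injectivity of the realisation map,
(GEN) by clearing denominators (`exists_mul_eq_aeval_root`), case (i), `O′ ⊇ R` dominating.  (4) The fact's tower
`B` has `B 0 = R[θ]_{𝔪_{O′} ∩ R[θ]} = R 0` (`realR_zero_eq_adjoin`) and, by induction, `B i = R i`: the centre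
`P` has `R i ⧸ P` regular and — `R i` being singular — `(R i)_P` singular, so isolatedness forces `P = 𝔪`, the step
is the quadratic transform along `O′`, uniqueness gives `B (i+1) = R (i+1)`.  (5) `B r = R r` regular: contradiction.
[cite: CossartPiltant2019, Thm. 1.5 (arXiv v1: Thm. 1.4), Def. 2.7, §2.1–2.2] [cite: Cutkosky2014, §2.1–2.2] [folklore]
-/

noncomputable section

-- `Summit.<S>.<S>.…` duplicates the summit name by design (single-problem summit).
set_option linter.dupNamespace false

open Polynomial IsLocalRing

namespace Summit.ResolutionOfSingularities.ResolutionOfSingularities.Theorems.SwitchingDichotomy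

open Literature.AlgebraicGeometry.Resolution

universe u

/-! ## (1) The first realised member and (GEN) -/

namespace RadicandChainRealisation

section QT

variable (p : ℕ) [hp : Fact p.Prime] {L : Type u} [Field L] (S : ℕ → Subring L)
variable [∀ m, IsLocalRing (S m)] (f : ∀ m, S m)
variable [Fact (Irreducible (radPoly p S f))] (g : ∀ m, S m) (x : ∀ m, S (m + 1))
variable (hθ : ∀ m, theta p S f g x m ^ p = emb p S f m (f m))

omit hp [∀ m, IsLocalRing (S m)] in
/-- `R 0 = im(S 0)[θ]`: the first realised member is the subring generated by the image of `S 0` and the root.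
[folklore] -/
theorem realR_zero_eq_adjoin :
    realR p S f g x hθ 0 =
      (Algebra.adjoin (emb p S f 0).range ({AdjoinRoot.root (radPoly p S f)} : Set (AdjoinRoot (radPoly p S f)))).toSubring := by
  apply le_antisymm
  · refine lift_range_le _ _ (fun s => ?_) ?_
    · exact Subalgebra.algebraMap_mem
        (Algebra.adjoin (emb p S f 0).range ({AdjoinRoot.root (radPoly p S f)} : Set _)) ⟨emb p S f 0 s, s, rfl⟩
    · rw [theta_zero]
      exact Algebra.self_mem_adjoin_singleton _ _
  · rw [Algebra.adjoin_eq_ring_closure]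
    refine Subring.closure_le.mpr (Set.union_subset ?_ ?_)
    · rintro _ ⟨⟨_, s, rfl⟩, rfl⟩
      exact emb_mem_realR p S f g x hθ 0 s
    · rintro z hz
      rw [Set.mem_singleton_iff.mp hz, ← theta_zero p S f g x]
      exact theta_mem_realR p S f g x hθ 0

omit hp [∀ m, IsLocalRing (S m)] in
/-- **(GEN) for the realisation field**: every element of `K′ = Frac(S 0)[θ]/(θ^p − f 0)` becomes a polynomial in
the root with coefficients from `im(S 0)` after multiplication by a non-zero element of `im(S 0)` — provided every
member `S n` consists of fractions of elements of `S 0`. [folklore] -/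
theorem exists_mul_eq_aeval_root
    (hfrac0 : ∀ n (s : S n), ∃ a b : S 0, (b : L) ≠ 0 ∧ (s : L) = (a : L) / (b : L))
    (z : AdjoinRoot (radPoly p S f)) :
    ∃ (G : ((emb p S f 0).range)[X]) (s : (emb p S f 0).range), s ≠ 0 ∧
      z * (s : AdjoinRoot (radPoly p S f)) = aeval (AdjoinRoot.root (radPoly p S f)) G := by
  classical
  -- the property, over `S 0`
  let M : AdjoinRoot (radPoly p S f) → Prop := fun z =>
    ∃ (G : (S 0)[X]) (s : S 0), s ≠ 0 ∧ z * emb p S f 0 s = G.eval₂ (emb p S f 0) (AdjoinRoot.root (radPoly p S f))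
  have hinj0 : Function.Injective (emb p S f 0) := emb_injective p S f 0
  have hM0 : M 0 := ⟨0, 1, one_ne_zero, by simp⟩
  have hMadd : ∀ a b, M a → M b → M (a + b) := by
    rintro a b ⟨Ga, sa, hsa, ha⟩ ⟨Gb, sb, hsb, hb⟩
    refine ⟨Ga * C sb + Gb * C sa, sa * sb, mul_ne_zero hsa hsb, ?_⟩
    rw [map_mul, eval₂_add, eval₂_mul, eval₂_mul, eval₂_C, eval₂_C, ← ha, ← hb]
    ring
  have hMmul : ∀ a b, M a → M b → M (a * b) := by
    rintro a b ⟨Ga, sa, hsa, ha⟩ ⟨Gb, sb, hsb, hb⟩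
    refine ⟨Ga * Gb, sa * sb, mul_ne_zero hsa hsb, ?_⟩
    rw [map_mul, eval₂_mul, ← ha, ← hb]
    ring
  have hMroot : M (AdjoinRoot.root (radPoly p S f)) := ⟨X, 1, one_ne_zero, by simp⟩
  -- constants: fractions of elements of `S 0`
  have hfracU : ∀ a ∈ Subring.closure (⋃ m, (S m : Set L)), ∃ u v : S 0, (v : L) ≠ 0 ∧ a = (u : L) / (v : L) := by
    intro a ha
    induction ha using Subring.closure_induction with
    | mem a h =>
      obtain ⟨m, hm⟩ := Set.mem_iUnion.mp h
      exact hfrac0 m ⟨a, hm⟩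
    | zero => exact ⟨0, 1, by simp, by simp⟩
    | one => exact ⟨1, 1, by simp, by simp⟩
    | add a b _ _ ha hb =>
      obtain ⟨u, v, hv, rfl⟩ := ha
      obtain ⟨u', v', hv', rfl⟩ := hb
      refine ⟨u * v' + u' * v, v * v', by simp [hv, hv'], ?_⟩
      push_cast
      field_simp
    | neg a _ ha =>
      obtain ⟨u, v, hv, rfl⟩ := ha
      exact ⟨-u, v, hv, by push_cast; ring⟩
    | mul a b _ _ ha hb =>
      obtain ⟨u, v, hv, rfl⟩ := ha
      obtain ⟨u', v', hv', rfl⟩ := hb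
      refine ⟨u * u', v * v', by simp [hv, hv'], ?_⟩
      push_cast
      field_simp
  have hMof : ∀ c : baseField S, M (AdjoinRoot.of (radPoly p S f) c) := by
    intro c
    obtain ⟨a, ha, b, hb, hab⟩ := Subfield.mem_closure_iff.mp c.2
    obtain ⟨u, v, hv, rfl⟩ := hfracU a ha
    obtain ⟨u', v', hv', rfl⟩ := hfracU b hb
    by_cases hu' : (u' : L) = 0
    · have hc : c = 0 := Subtype.ext (by rw [← hab, hu', zero_div, div_zero]; rfl)
      rw [hc, map_zero]; exact hM0
    · refine ⟨C (u * v'), v * u', ?_, ?_⟩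
      · intro h0
        have := congrArg (fun t : S 0 => (t : L)) h0
        push_cast at this
        exact (mul_ne_zero hv hu') this
      · rw [eval₂_C, emb_apply, emb_apply, ← map_mul]
        congr 1
        apply Subtype.ext
        change (c : L) * ((v * u' : S 0) : L) = ((u * v' : S 0) : L)
        rw [← hab]
        push_cast
        field_simp
  -- every element
  have hMall : ∀ z, M z := by
    intro z
    induction z using AdjoinRoot.induction_on with
    | ih P =>
      induction P using Polynomial.induction_on with
      | C c => rw [AdjoinRoot.mk_C]; exact hMof c
      | add P Q hP hQ => rw [map_add]; exact hMadd _ _ hP hQ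
      | monomial n c hPn =>
        rw [pow_succ, ← mul_assoc, map_mul, AdjoinRoot.mk_X]
        exact hMmul _ _ hPn hMroot
  -- move the coefficients into `im(S 0)`
  obtain ⟨G, s, hs, hz⟩ := hMall z
  refine ⟨G.map (emb p S f 0).rangeRestrict, ⟨emb p S f 0 s, s, rfl⟩, fun h0 => hs (hinj0 ?_), ?_⟩
  · have := congrArg Subtype.val h0
    simpa using this
  · rw [aeval_def, eval₂_map]
    exact hz

end QT

end RadicandChainRealisation

/-! ## (2) The bridge -/

namespace HironakaLUBranchOfCP

open RadicandChainRealisation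

/-- **The branch-local fact from the printed shape of Cossart–Piltant's local theorem** (flatness-free centre
clause): `CossartPiltant2019LocalPermissibleSing → CossartPiltant2019HironakaLUIsolatedBranch`.  See the module
docstring for the proof.  With it, the K(3) consumer `NoEternalChainThree.noEternalIsolatedRadicandChain_three`
(p509311) runs on the verbatim-shaped debt:
`noEternalIsolatedRadicandChain_three (hironakaLUIsolatedBranch_of_localPermissibleSing hCP)`.
[cite: CossartPiltant2019, Thm. 1.5 (arXiv v1: Thm. 1.4), Def. 2.7 (i), §2.1–2.2] [cite: Cutkosky2014, §2.2] [folklore] -/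
theorem hironakaLUIsolatedBranch_of_localPermissibleSing (hCP : CossartPiltant2019LocalPermissibleSing.{u}) :
    CossartPiltant2019HironakaLUIsolatedBranch.{u} := by
  intro p hp K _ _ O S _ hle f θ u hreg hexc hdim hdom0 hQTA hspan hrel hred hisol
  classical
  haveI := Fact.mk hp
  by_contra hall
  push Not at hall
  -- (0) the base chain
  have hQT : ∀ m, IsQuadraticTransform (S m) (S (m + 1)) := fun m =>
    (hQTA m).isQuadraticTransform (sequence_dominates hdom0 hQTA m).1
  have hx0 : ∀ m, (u m : K) ≠ 0 := fun m => by
    obtain ⟨_, x', hx'𝔪, hx'0, _, hbl, -, -⟩ := hQT m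
    obtain ⟨-, -, -, -, -, h⟩ := exists_unit_ratio (hle m) hx'𝔪 (fun e => hx'0 (Subtype.ext e)) hbl (hspan m)
    exact h
  have hnf : ∀ m, ¬ IsField (S m) := fun m hF => by
    obtain ⟨_, x', hx'𝔪, hx'0, -⟩ := hQT m
    exact hx'0 (by rwa [isField_iff_maximalIdeal_eq.mp hF, Ideal.mem_bot] at hx'𝔪)
  have hsub : ∀ n, (S n : Set K) ⊆ (Subfield.closure (S 0 : Set K) : Set K) := by
    intro n
    induction n with
    | zero => exact Subfield.subset_closure
    | succ n ih =>
      intro s hs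
      obtain ⟨_, x', _, _, _, _, hfrac, -⟩ := hQT n
      obtain ⟨a, ha, b, hb, -, rfl⟩ := hfrac s hs
      have hBl : ∀ z, z ∈ blowupRing (S n) (x' : K) → z ∈ Subfield.closure (S 0 : Set K) := by
        intro z hz
        unfold blowupRing at hz
        induction hz using Subring.closure_induction with
        | mem z h =>
          rcases h with h | ⟨y, _, rfl⟩
          · exact ih h
          · exact div_mem (ih y.2) (ih x'.2)
        | zero => exact zero_mem _
        | one => exact one_mem _
        | add _ _ _ _ ha hb => exact add_mem ha hb
        | neg _ _ ha => exact neg_mem ha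
        | mul _ _ _ _ ha hb => exact mul_mem ha hb
      exact div_mem (hBl a ha) (hBl b hb)
  have hfrac0 : ∀ n (s : S n), ∃ a b : S 0, (b : K) ≠ 0 ∧ (s : K) = (a : K) / (b : K) := by
    intro n s
    obtain ⟨a, ha, b, hb, hab⟩ := Subfield.mem_closure_iff.mp (hsub n s.2)
    rw [Subring.closure_eq] at ha hb
    by_cases hb0 : b = 0
    · exact ⟨0, 1, by simp, by rw [← hab, hb0, div_zero]; simp⟩
    · exact ⟨⟨a, ha⟩, ⟨b, hb⟩, hb0, hab.symm⟩
  -- (1) realisation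
  have hnr : ∀ m (a b : S m), b ≠ 0 → ((a : K) / (b : K)) ^ p ≠ (f m : K) :=
    fun m a b hb => pow_ne_of_isolated (S m) (hnf m) (f m) (hisol m) a b hb
  have hirr : Irreducible (radPoly p S f) := by
    refine X_pow_sub_C_irreducible_of_prime hp fun b hb => ?_
    have hbL : (b : K) ∈ Subfield.closure (S 0 : Set K) := by
      refine (Subfield.closure_le.mpr ?_) b.2
      exact Set.iUnion_subset hsub
    obtain ⟨a, ha, c, hc, hac⟩ := Subfield.mem_closure_iff.mp hbL
    rw [Subring.closure_eq] at ha hc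
    have hb' : ((b : K)) ^ p = (f 0 : K) := by
      have := congrArg (fun z : baseField S => (z : K)) hb
      simpa using this
    by_cases hc0 : c = 0
    · apply hnr 0 0 1 one_ne_zero
      rw [← hb', ← hac, hc0, div_zero]; simp [zero_pow hp.ne_zero]
    · exact hnr 0 ⟨a, ha⟩ ⟨c, hc⟩ (fun h => hc0 (congrArg Subtype.val h)) (by simpa [hac] using hb')
  haveI : Fact (Irreducible (radPoly p S f)) := ⟨hirr⟩
  have hθ : ∀ m, theta p S f θ u m ^ p = emb p S f m (f m) := theta_pow p S f θ u hx0 hrel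
  have hinj : ∀ m, Function.Injective (phi p S f θ u hθ m) := fun m =>
    phi_injective p S f θ u hθ m fun a b hb => hnr m a b hb
  -- locality of the germs WITHOUT cleaning: `f m − (θ m)^p = (u m)^p · f (m+1) ∈ 𝔪_m`
  have hu𝔪 : ∀ m, u m ∈ maximalIdeal (S (m + 1)) := fun m => by
    have : u m ∈ Ideal.span {u m} := Ideal.mem_span_singleton_self _
    rw [← hspan m] at this
    refine (Ideal.span_le.mpr ?_) this
    rintro _ ⟨y, hy, rfl⟩
    exact NoEternalChainOne.inclusion_mem_maximalIdeal_of_subringDominates (hQT m).dominates hy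
  have hfg : ∀ m, f m - θ m ^ p ∈ maximalIdeal (S m) := fun m => by
    apply mem_maximalIdeal_of_inclusion_mem (hle m)
    have : (⟨((f m - θ m ^ p : S m) : K), hle m (f m - θ m ^ p).2⟩ : S (m + 1)) = f (m + 1) * u m ^ p :=
      Subtype.ext (by push_cast; exact (hrel m).symm)
    rw [this]
    exact Ideal.mul_mem_left _ _ (Ideal.pow_mem_of_mem _ (hu𝔪 m) _ hp.pos)
  haveI hTloc : ∀ m, IsLocalRing (AdjoinRoot ((X : (S m)[X]) ^ p - C (f m))) :=
    fun m => isLocalRing_adjoinRoot (f m) (θ m) (hfg m)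
  haveI hRloc : ∀ m, IsLocalRing (realR p S f θ u hθ m) := fun m => (equivRealR p S f θ u hθ m (hinj m)).isLocalRing
  haveI hRnoeth : ∀ m, IsNoetherianRing (realR p S f θ u hθ m) := fun m =>
    haveI := hreg m
    isNoetherianRing_of_ringEquiv (AdjoinRoot ((X : (S m)[X]) ^ p - C (f m))) (equivRealR p S f θ u hθ m (hinj m))
  -- the realised chain: quadratic transforms, singular, isolated
  have hQTR : ∀ m, IsQuadraticTransform (realR p S f θ u hθ m) (realR p S f θ u hθ (m + 1)) := fun m =>
    isQuadraticTransform_realR_of_isLocalRing p S f θ u hθ hle hx0 m hinj (hQT m) (hspan m) (hrel m)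
  have hRsing : ∀ m, ¬ IsRegularLocalRing (realR p S f θ u hθ m) := fun m hR =>
    hall m (IsRegularLocalRing.of_ringEquiv (equivRealR p S f θ u hθ m (hinj m)).symm)
  have hRisol : ∀ m (P : Ideal (realR p S f θ u hθ m)) [P.IsPrime],
      (∃ Q : Ideal (realR p S f θ u hθ m), Q.IsPrime ∧ P < Q) → IsRegularLocalRing (Localization.AtPrime P) :=
    fun m P _ hP => isolated_of_ringEquiv (equivRealR p S f θ u hθ m (hinj m)) (hisol m) P hP
  -- (2) a valuation ring of `K′` dominating the realised chain
  obtain ⟨O', hO'⟩ := exists_valuationSubring_dominates (realR p S f θ u hθ) fun m => (hQTR m).dominates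
  -- (3) the frame of the fact
  set Kp := AdjoinRoot (radPoly p S f) with hKp
  haveI : CharP Kp p := charP_adjoinRoot_radPoly p S f
  set R : Subring Kp := (emb p S f 0).range with hRdef
  set e0 : S 0 ≃+* R := RingEquiv.ofBijective (emb p S f 0).rangeRestrict
    ⟨fun a b hab => emb_injective p S f 0 (congrArg Subtype.val hab), RingHom.rangeRestrict_surjective _⟩ with he0
  have he0val : ∀ s : S 0, ((e0 s : R) : Kp) = emb p S f 0 s := fun _ => rfl
  haveI := hreg 0
  haveI : IsRegularLocalRing R := IsRegularLocalRing.of_ringEquiv e0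
  have hexcR : IsExcellentRing R := (hexc 0).of_ringEquiv e0
  have hdimR : ringKrullDim R = 3 := by rw [← ringKrullDim_eq_of_ringEquiv e0, hdim 0]; rfl
  have hcharR : CharP (ResidueField R) p := charP_residueField_subring p R
  set P0 : (S 0)[X] := (X : (S 0)[X]) ^ p - C (f 0) with hP0
  set h : R[X] := P0.map e0.toRingHom with hh
  set ρ : Kp := AdjoinRoot.root (radPoly p S f) with hρ
  have hmon0 : P0.Monic := monic_X_pow_sub_C' (f 0)
  have hmon : h.Monic := hmon0.map _
  have hdeg : h.natDegree = p := by rw [hh, hmon0.natDegree_map, hP0, natDegree_X_pow_sub_C]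
  have hcomp : (algebraMap R Kp).comp e0.toRingHom = emb p S f 0 := RingHom.ext fun s => rfl
  have haeval : ∀ G : (S 0)[X], aeval ρ (G.map e0.toRingHom) = phi p S f θ u hθ 0 (AdjoinRoot.mk _ G) := by
    intro G
    rw [aeval_def, eval₂_map, hcomp, phi_mk, theta_zero]
  have hx : aeval ρ h = 0 := by rw [hh, haeval, AdjoinRoot.mk_self, map_zero]
  have hmin : ∀ G : R[X], G.natDegree < p → aeval ρ G = 0 → G = 0 := fun G hG hG0 => by
    obtain ⟨G', rfl⟩ : ∃ G' : (S 0)[X], G = G'.map e0.toRingHom :=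
      ⟨G.map e0.symm.toRingHom, by
        rw [Polynomial.map_map]
        convert (Polynomial.map_id (R := R) (p := G)).symm
        ext s; simp⟩
    rw [haeval] at hG0
    have hmk : AdjoinRoot.mk _ G' = 0 := hinj 0 (by rw [hG0, map_zero])
    rw [AdjoinRoot.mk_eq_zero] at hmk
    have hinjE : Function.Injective e0.toRingHom := e0.injective
    have hdG : (G'.map e0.toRingHom).natDegree = G'.natDegree :=
      Polynomial.natDegree_map_eq_of_injective hinjE G'
    have hdeg' : G'.natDegree < P0.natDegree := by
      rw [hP0, natDegree_X_pow_sub_C, ← hdG]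
      exact hG
    by_contra hne
    have hne' : G' ≠ 0 := fun h0 => hne (by rw [h0, Polynomial.map_zero])
    exact hmon0.not_dvd_of_natDegree_lt hne' hdeg' hmk
  have hgen : ∀ z : Kp, ∃ (G : R[X]) (s : R), s ≠ 0 ∧ z * (s : Kp) = aeval ρ G :=
    exists_mul_eq_aeval_root p S f hfrac0
  have hcase : (CharP Kp p ∧ ∀ i, 0 < i → i < p → h.coeff i = 0) ∨
      (Nat.card (Kp ≃ₐ[R] Kp) = p ∧ ∀ σ : Kp ≃ₐ[R] Kp, ∀ y ∈ Algebra.adjoin R ({ρ} : Set Kp),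
        σ y ∈ Algebra.adjoin R ({ρ} : Set Kp)) := by
    refine Or.inl ⟨inferInstance, fun i hi hip => ?_⟩
    rw [hh, coeff_map, hP0, coeff_sub, coeff_X_pow, coeff_C, if_neg hip.ne, if_neg hi.ne', sub_zero, map_zero]
  have hR0le : R ≤ realR p S f θ u hθ 0 := by rintro _ ⟨s, rfl⟩; exact emb_mem_realR p S f θ u hθ 0 s
  have hRO' : R ≤ O'.toSubring := hR0le.trans (hO' 0).1
  have hdomR : ∀ r : R, r ∈ maximalIdeal R → O'.valuation (r : Kp) < 1 := fun r hr => by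
    obtain ⟨s, rfl⟩ := e0.surjective r
    have hs : s ∈ maximalIdeal (S 0) := by
      rw [IsLocalRing.mem_maximalIdeal, mem_nonunits_iff] at hr ⊢
      exact fun hu => hr (hu.map e0)
    have h1 := emb_mem_maximalIdeal_realR p S f θ u hθ 0 (hinj 0) hs
    exact ((subringDominates_valuationSubring_iff (hO' 0).1).mp (hO' 0) _).mp h1
  -- (4) the tower of the fact IS the realised chain
  obtain ⟨r, B, hB0, hstep, hBreg⟩ :=
    hCP p hp Kp R hexcR hdimR hcharR h ρ hmon hdeg hx hmin hgen hcase O' hRO' hdomR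
  have hA : (Algebra.adjoin R ({ρ} : Set Kp)).toSubring = realR p S f θ u hθ 0 := by
    rw [realR_zero_eq_adjoin p S f θ u hθ]
  have key : ∀ n ≤ r, B n = realR p S f θ u hθ n := fun n hn => by
    induction n with
    | zero =>
      rw [hB0, hA]
      exact locAtCentre_eq_self_of_subringDominates (hO' 0)
    | succ n ih =>
      have hBn := ih (Nat.le_of_succ_le hn)
      obtain ⟨P, hPp, hPreg, hPsing, hblow⟩ := hstep n (Nat.lt_of_succ_le hn)
      have aux : ∀ (C : Subring Kp), C = realR p S f θ u hθ n → ∀ (P : Ideal C) (_ : P.IsPrime),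
          IsRegularLocalRing (C ⧸ P) → (¬ IsRegularLocalRing C → ¬ IsRegularLocalRing (Localization.AtPrime P)) →
          IsLocalBlowupAlong O' C P (B (n + 1)) → B (n + 1) = realR p S f θ u hθ (n + 1) := by
        intro C hC
        subst hC
        intro P _ hPreg hPsing hblow
        have hPns : ¬ IsRegularLocalRing (Localization.AtPrime P) := hPsing (hRsing n)
        have hPmax : P = maximalIdeal (realR p S f θ u hθ n) := by
          by_contra hne
          haveI := hPreg
          have hlt : P < maximalIdeal (realR p S f θ u hθ n) :=
            lt_of_le_of_ne (IsLocalRing.le_maximalIdeal (Ideal.IsPrime.ne_top inferInstance)) hne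
          exact hPns (hRisol n P ⟨maximalIdeal _, inferInstance, hlt⟩)
        subst hPmax
        have h1 : IsQuadraticTransformAlong O' (realR p S f θ u hθ n) (B (n + 1)) := ⟨inferInstance, hblow⟩
        have h2 : IsQuadraticTransformAlong O' (realR p S f θ u hθ n) (realR p S f θ u hθ (n + 1)) :=
          (hQTR n).along ⟨inferInstance, IsNoetherian.noetherian _⟩ (hO' (n + 1))
        exact h1.unique h2
      exact aux (B n) hBn P hPp hPreg hPsing hblow
  -- (5) contradiction at stage `r`
  exact hRsing r (by rw [← key r le_rfl]; exact hBreg)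

/-- **… and from the normally-flat rendering** (through Bennett, `localPermissibleSing_of_localPermissible`).
[cite: CossartPiltant2019, Thm. 1.5 (arXiv v1: Thm. 1.4)] [folklore] -/
theorem hironakaLUIsolatedBranch_of_localPermissible (hCP : CossartPiltant2019LocalPermissible.{u}) :
    CossartPiltant2019HironakaLUIsolatedBranch.{u} :=
  hironakaLUIsolatedBranch_of_localPermissibleSing (localPermissibleSing_of_localPermissible hCP)

end HironakaLUBranchOfCP

end Summit.ResolutionOfSingularities.ResolutionOfSingularities.Theorems.SwitchingDichotomy

end
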